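import Summits.QuantumFields.QCD.Theorems.QuarksAsStableActionStableActionBridgeSliceKernelGlue

/-!
# Slicing dictionary for the assembled four-torus configuration
(crux `QuarksAsStableAction.StableActionBridge`, item stmt-QuantumFields-9737, line `Sketch`;
registered stubs `timeSlice_of_timeAssemble` and `prod_gaugeSliceKernel_cycle_eq_exp` of the lead
skeleton)

The Yang–Mills side of the tree slices a four-torus configuration across Euclidean time with the
assembling map
`asm (Us, gs) := fun e' : Edge 4 N => Fin.cons (gs (e'.1 0) (Fin.tail e'.1)) (fun i => Us (e'.1 0) (Fin.tail e'.1, i)) e'.2`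
(spatial links of slice `t` are `Us t : GaugeConfig 3 N G`, temporal links leaving slice `t` are
`gs t : sites → G`).  The fermionic theorems read a four-torus field `U` through the slice maps
`e ↦ U (Fin.cons t e.1, e.2.succ)` (spatial links at time `t`) and `y ↦ U (Fin.cons t y, 0)`
(temporal links at time `t`).

* `timeSlice_of_timeAssemble`: the slice maps invert `asm` (`Fin.cons_zero`, `Fin.tail_cons`,
  `Fin.cons_succ`).
* `prod_gaugeSliceKernel_cycle_eq_exp`: the cyclic product over Euclidean time of the temporal-gauge
  transfer kernels `K_β(Us t, (Us (t+1))^{gs t})`, with the temporal links put back as gauge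
  transformations of the next slice, is the full Boltzmann weight
  `exp(−β Σ_t (S₃(Us t) + S_tm(Us t, gs t, Us (t+1))))`: each factor is
  `e^{−β S₃(Us t)/2} e^{−β S_tm} e^{−β S₃(Us (t+1))/2}` (`gaugeSliceKernel_gaugeTransform_right`) and the
  half spatial actions telescope round the time cycle (reindex along `t ↦ t + 1` of `ZMod N`).

[cite: Smit2023, §4.6 (4.121)–(4.137)] [cite: OsterwalderSeiler1978, §2]
-/

noncomputable section

open MeasureTheory Matrix Literature.MathematicalPhysics.QuantumFieldTheory
  Literature.MathematicalPhysics.QuantumLattice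
open Literature.Probability.LatticeModels (TorusSite)

namespace Summit.QuantumFields.QCD.Cruxes.StableActionBridge.Sketch

/-- **The slice maps invert the assembling map**: reading the spatial links at time `t`
(`e ↦ U (Fin.cons t e.1, e.2.succ)`) of the assembled configuration `asm (Us, gs)` returns `Us t`, and
reading its temporal links at time `t` (`y ↦ U (Fin.cons t y, 0)`) returns `gs t`. [folklore] -/
theorem timeSlice_of_timeAssemble : ∀ (N : ℕ) [NeZero N] (G : Type) (Us : ZMod N → GaugeConfig 3 N G) (gs : ZMod N → TorusSite 3 N → G) (t : ZMod N), (fun e : Edge 3 N => (fun e' : Edge 4 N => (Fin.cons (gs (e'.1 0) (Fin.tail e'.1)) (fun i : Fin 3 => Us (e'.1 0) (Fin.tail e'.1, i)) : Fin 4 → G) e'.2) ((Fin.cons t e.1 : TorusSite 4 N), e.2.succ)) = Us t ∧ (fun y : TorusSite 3 N => (fun e' : Edge 4 N => (Fin.cons (gs (e'.1 0) (Fin.tail e'.1)) (fun i : Fin 3 => Us (e'.1 0) (Fin.tail e'.1, i)) : Fin 4 → G) e'.2) ((Fin.cons t y : TorusSite 4 N), 0)) = gs t := by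
  intro N _ G Us gs t
  refine ⟨funext fun e => ?_, funext fun y => ?_⟩
  · simp only [Fin.cons_succ, Fin.cons_zero, Fin.tail_cons, Prod.mk.eta]
  · simp only [Fin.cons_zero, Fin.tail_cons]

-- The telescoping step is adapted from `exp_neg_mul_sum_eq_prod` in
-- `Summits/QuantumFields/YangMills/Theorems/PencilRigidityWeakCouplingHypercubicLimitStubTransferRepresentation.lean`
-- and `prod_exp_mul_prod_eq_prod_symm` in `Literature/MathematicalPhysics/QuantumFieldTheory/SlabTransferKernel.lean`.
/-- **The cyclic product of the temporal-gauge kernels is the Boltzmann weight**: with the temporal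
links `gs t` put back as gauge transformations of the next slice,
`∏_t K_β(Us t, (Us (t+1))^{gs t}) = exp(−β Σ_t (S₃(Us t) + S_tm(Us t, gs t, Us (t+1))))`,
`S₃ = wilsonAction` of the spatial three-torus and `S_tm = sliceTemporalAction`, both in the
fundamental representation of `SU(3)`; the two half spatial actions of each kernel telescope round
the time cycle `ZMod N`. [cite: Smit2023, §4.6 (4.121)–(4.137)] [cite: OsterwalderSeiler1978, §2] -/
theorem prod_gaugeSliceKernel_cycle_eq_exp : ∀ (N : ℕ) [NeZero N] (β : ℝ) (Us : ZMod N → GaugeConfig 3 N (Matrix.specialUnitaryGroup (Fin 3) ℂ)) (gs : ZMod N → TorusSite 3 N → Matrix.specialUnitaryGroup (Fin 3) ℂ), ∏ t : ZMod N, gaugeSliceKernel β (Us t) (gaugeTransform (gs t) (Us (t + 1))) = Real.exp (-(β * ∑ t : ZMod N, (wilsonAction (fundamentalRep (Fin 3)) (Us t) + sliceTemporalAction (fundamentalRep (Fin 3)) (Us t) (gs t) (Us (t + 1))))) := by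
  intro N _ β Us gs
  simp_rw [gaugeSliceKernel_gaugeTransform_right]
  have hshift : ∏ t : ZMod N, Real.exp (-(β * wilsonAction (fundamentalRep (Fin 3)) (Us (t + 1)) / 2)) =
      ∏ t : ZMod N, Real.exp (-(β * wilsonAction (fundamentalRep (Fin 3)) (Us t) / 2)) :=
    Fintype.prod_equiv (Equiv.addRight 1) _ _ fun t => rfl
  rw [Finset.prod_mul_distrib, Finset.prod_mul_distrib, hshift, ← Finset.prod_mul_distrib,
    ← Finset.prod_mul_distrib, Finset.mul_sum, ← Finset.sum_neg_distrib, Real.exp_sum]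
  refine Finset.prod_congr rfl fun t _ => ?_
  rw [← Real.exp_add, ← Real.exp_add]
  congr 1
  ring

end Summit.QuantumFields.QCD.Cruxes.StableActionBridge.Sketch

end
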